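import Summits.NavierStokesRegularity.NavierStokesRegularity.Theorems.GaldiLiouvilleGateParabolicGaldiLiouvilleSelfSimilarGate
import HarnessLib

/-!
# Crux `ParabolicGaldiLiouville` (stmt-NavierStokesRegularity-0893), line `birth`/`registered`:
# the FIXED-POINT CERTIFICATE — every registered open stub of the line is EQUIVALENT to the crux

Support file (`--supports stmt-NavierStokesRegularity-0893`; lead c3, cycle 4; theorems only, no
sorry, standard axioms).

X2 = `GaldiLiouvilleGate.ParabolicGaldiLiouville`: a smooth bounded ancient mild solution `v` of
Navier–Stokes (`ν = 1`) on `ℝ³ × (−∞,0)` with `sup_{s<0} ∫|∇v(s)|² < ∞` and `v(s) ∈ L⁶` for all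
`s < 0` is `≡ 0`.

The line has been reshaped four times (leads c1, c2); each reshaping left ONE open stub, a
property `P(v)` asserted for every `v` of the X2 class, and closed `P ⇒ (v ≡ 0)` in the class
with the tree's proved Liouville theorems (Seregin 2014 Thm 4.12 at `(9,3)` and `(6,4)`;
Albritton–Barker 2019 Thm 1.2; zero-drift small-data `L⁶` stability):

* reshaping 1 (birth): `P₁` = finite total dissipation `∫_{s<0} E(s) ds < ∞`, `E(s) = ∫|∇v(s)|_F²`;
* reshaping 2 (sharp gate): `P₂` = square-integrable enstrophy history `∫_{s<0} E(s)² ds < ∞`;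
* reshaping 3 (two-gate): `P₃` = `P₂ ∨ B`, `B` = `L³` norms bounded along one sequence `τ_k → −∞`;
* reshaping 4 (sharp two-gate): `P₄` = `A ∨ B`, `A` = self-similar-rate liminf
  `∀ ε > 0, ∀ R > 0, ∃ σ < −R, ‖v(σ)‖₆⁴ |σ| < ε`.

Since each `Pᵢ` holds trivially for `v ≡ 0`, the crux implies every stub; and each stub implies
the crux through the landed gates. Hence **all four open stubs are equivalent to the crux itself**
(and to each other): the line is at its fixed point — no reshaping inside it changes the open
content, which is exactly X2, and X2 contains Galdi's Liouville problem (crux 0895,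
`galdiLiouville_of_parabolicGaldiLiouville`, `galdiLiouville_of_sharpTwoGate`; Leray 1933, open in
print: Wang–Yang, arXiv:2608.06040 (2026), abstract, "remains open, even for axisymmetric
D-solutions").

* `parabolicGaldiLiouville_of_sharpTwoGate` / `sharpTwoGate_of_parabolicGaldiLiouville` /
  `parabolicGaldiLiouville_iff_sharpTwoGate` — reshaping 4 (the registered stub `stub_sharpTwoGate`);
* `parabolicGaldiLiouville_iff_twoGate` — reshaping 3;
* `parabolicGaldiLiouville_iff_sqIntegrableEnstrophy` — reshaping 2;
* `parabolicGaldiLiouville_iff_finiteDissipation` — reshaping 1 (birth).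

References: G. Seregin, *Lecture Notes on Regularity Theory for the NSE* (2014), Thm 4.12;
D. Albritton, T. Barker, J. Math. Fluid Mech. 21 (2019) no. 43 = arXiv:1811.00502, Thm 1.2;
G. P. Galdi, *An Introduction to the Mathematical Theory of the NSE* (2011), Rem. X.9.4.
-/

noncomputable section

-- `Sub = summit`: the duplicated namespace component `NavierStokesRegularity` is deliberate.
set_option linter.dupNamespace false

namespace Summit.NavierStokesRegularity.NavierStokesRegularity.Theorems.ParabolicGaldiLiouville.Birth

open MeasureTheory Filter Topology Set Function
open scoped ENNReal NNReal
open Literature.Analysis Literature.Analysis.FluidPDE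

namespace FixedPoint

/-- Under the crux, every slice of a flow of the class is the zero function. -/
theorem slice_eq_zero (hX2 : Theses.GaldiLiouvilleGate.ParabolicGaldiLiouville)
    {v : ℝ → EuclideanSpace ℝ (Fin 3) → EuclideanSpace ℝ (Fin 3)}
    (hv : IsBoundedAncientMildSolution 1 v)
    (hsm : ContDiffOn ℝ (⊤ : ℕ∞) (uncurry v) (Iio 0 ×ˢ univ))
    (hens : ∃ C : NNReal, ∀ s < 0, ∫⁻ y, ENNReal.ofReal (frobeniusNormSq (fderiv ℝ (v s) y)) ≤ C)
    (hL6 : ∀ s < 0, MemLp (v s) 6 volume) {s : ℝ} (hs : s < 0) :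
    v s = fun _ => 0 :=
  funext (hX2 v hv hsm hens hL6 s hs)

/-- Under the crux, the enstrophy history of a flow of the class has `∫_{s<0} E(s)^n ds = 0`
for every exponent `n ≥ 1` (used with `n = 1, 2`). -/
theorem lintegral_enstrophy_pow_eq_zero (hX2 : Theses.GaldiLiouvilleGate.ParabolicGaldiLiouville)
    {v : ℝ → EuclideanSpace ℝ (Fin 3) → EuclideanSpace ℝ (Fin 3)}
    (hv : IsBoundedAncientMildSolution 1 v)
    (hsm : ContDiffOn ℝ (⊤ : ℕ∞) (uncurry v) (Iio 0 ×ˢ univ))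
    (hens : ∃ C : NNReal, ∀ s < 0, ∫⁻ y, ENNReal.ofReal (frobeniusNormSq (fderiv ℝ (v s) y)) ≤ C)
    (hL6 : ∀ s < 0, MemLp (v s) 6 volume) {n : ℕ} (hn : n ≠ 0) :
    (∫⁻ s in Iio 0, (∫⁻ y, ENNReal.ofReal (frobeniusNormSq (fderiv ℝ (v s) y))) ^ n) = 0 := by
  have hint : ∀ s ∈ Iio (0 : ℝ),
      (∫⁻ y, ENNReal.ofReal (frobeniusNormSq (fderiv ℝ (v s) y))) ^ n = 0 := fun s hs => by
    simp [slice_eq_zero hX2 hv hsm hens hL6 hs, frobeniusNormSq_zero, hn]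
  rw [setLIntegral_congr_fun measurableSet_Iio hint, lintegral_zero]

/-- Under the uniform bound `E(s) ≤ C`, `E(s)² ≤ C · E(s)`, so finite total dissipation gives a
square-integrable enstrophy history (reshaping 1 ⇒ reshaping 2). -/
theorem sqIntegrableEnstrophy_of_finiteDissipation
    {v : ℝ → EuclideanSpace ℝ (Fin 3) → EuclideanSpace ℝ (Fin 3)}
    (hens : ∃ C : NNReal, ∀ s < 0, ∫⁻ y, ENNReal.ofReal (frobeniusNormSq (fderiv ℝ (v s) y)) ≤ C)
    (hdiss : (∫⁻ s in Iio 0, ∫⁻ y, ENNReal.ofReal (frobeniusNormSq (fderiv ℝ (v s) y))) < ⊤) :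
    (∫⁻ s in Iio 0, (∫⁻ y, ENNReal.ofReal (frobeniusNormSq (fderiv ℝ (v s) y))) ^ 2) < ⊤ := by
  obtain ⟨C, hC⟩ := hens
  have hle : ∀ s ∈ Iio (0 : ℝ),
      (∫⁻ y, ENNReal.ofReal (frobeniusNormSq (fderiv ℝ (v s) y))) ^ 2 ≤
        (C : ℝ≥0∞) * ∫⁻ y, ENNReal.ofReal (frobeniusNormSq (fderiv ℝ (v s) y)) := fun s hs => by
    rw [pow_two]
    gcongr
    exact hC s hs
  calc (∫⁻ s in Iio 0, (∫⁻ y, ENNReal.ofReal (frobeniusNormSq (fderiv ℝ (v s) y))) ^ 2)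
      ≤ ∫⁻ s in Iio 0, (C : ℝ≥0∞) * ∫⁻ y, ENNReal.ofReal (frobeniusNormSq (fderiv ℝ (v s) y)) :=
        setLIntegral_mono' measurableSet_Iio hle
    _ = (C : ℝ≥0∞) * ∫⁻ s in Iio 0, ∫⁻ y, ENNReal.ofReal (frobeniusNormSq (fderiv ℝ (v s) y)) :=
        lintegral_const_mul' _ _ ENNReal.coe_ne_top
    _ < ⊤ := ENNReal.mul_lt_top ENNReal.coe_lt_top hdiss

end FixedPoint

/-- **The registered stub implies the crux** (the composition of the sharp two-gate skeleton, with
the landed gates): GATE A ⇒ `parabolicGaldiLiouville_selfSimilarGate` (zero-drift `L⁶` stability,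
p165798/p166404), GATE B ⇒ `parabolicGaldiLiouville_L3Corner` (Albritton–Barker Thm 1.2, p164882). -/
theorem parabolicGaldiLiouville_of_sharpTwoGate
    (hstub : ∀ v : ℝ → EuclideanSpace ℝ (Fin 3) → EuclideanSpace ℝ (Fin 3),
      Literature.Analysis.FluidPDE.IsBoundedAncientMildSolution 1 v →
      ContDiffOn ℝ (⊤ : ℕ∞) (Function.uncurry v) (Set.Iio 0 ×ˢ Set.univ) →
      (∃ C : NNReal, ∀ s < 0, ∫⁻ y, ENNReal.ofReal
          (Literature.Analysis.FluidPDE.frobeniusNormSq (fderiv ℝ (v s) y)) ≤ C) →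
      (∀ s < 0, MeasureTheory.MemLp (v s) 6 MeasureTheory.volume) →
      (∀ ε : ENNReal, 0 < ε → ∀ R : ℝ, 0 < R → ∃ σ : ℝ, σ < -R ∧
        MeasureTheory.eLpNorm (v σ) 6 MeasureTheory.volume ^ (4 : ℝ) * ENNReal.ofReal (-σ) < ε) ∨
      (∃ (τ : ℕ → ℝ) (M : ENNReal), M < ⊤ ∧ Filter.Tendsto τ Filter.atTop Filter.atBot ∧
        (∀ k, τ k < 0) ∧ ∀ k, MeasureTheory.eLpNorm (v (τ k)) 3 MeasureTheory.volume ≤ M)) :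
    Theses.GaldiLiouvilleGate.ParabolicGaldiLiouville := by
  intro v hv hsm hens hL6
  rcases hstub v hv hsm hens hL6 with hA | hB
  · exact parabolicGaldiLiouville_selfSimilarGate v hv hsm hens hL6 hA
  · exact parabolicGaldiLiouville_L3Corner v hv hsm hens hL6 hB

/-- **The crux implies the registered stub**: `v ≡ 0` has `‖v(σ)‖₆ = 0` at every `σ < 0`, so
GATE A holds with the witness `σ = −R − 1`. -/
theorem sharpTwoGate_of_parabolicGaldiLiouville
    (hX2 : Theses.GaldiLiouvilleGate.ParabolicGaldiLiouville) :
    ∀ v : ℝ → EuclideanSpace ℝ (Fin 3) → EuclideanSpace ℝ (Fin 3),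
      Literature.Analysis.FluidPDE.IsBoundedAncientMildSolution 1 v →
      ContDiffOn ℝ (⊤ : ℕ∞) (Function.uncurry v) (Set.Iio 0 ×ˢ Set.univ) →
      (∃ C : NNReal, ∀ s < 0, ∫⁻ y, ENNReal.ofReal
          (Literature.Analysis.FluidPDE.frobeniusNormSq (fderiv ℝ (v s) y)) ≤ C) →
      (∀ s < 0, MeasureTheory.MemLp (v s) 6 MeasureTheory.volume) →
      (∀ ε : ENNReal, 0 < ε → ∀ R : ℝ, 0 < R → ∃ σ : ℝ, σ < -R ∧
        MeasureTheory.eLpNorm (v σ) 6 MeasureTheory.volume ^ (4 : ℝ) * ENNReal.ofReal (-σ) < ε) ∨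
      (∃ (τ : ℕ → ℝ) (M : ENNReal), M < ⊤ ∧ Filter.Tendsto τ Filter.atTop Filter.atBot ∧
        (∀ k, τ k < 0) ∧ ∀ k, MeasureTheory.eLpNorm (v (τ k)) 3 MeasureTheory.volume ≤ M) := by
  intro v hv hsm hens hL6
  refine Or.inl fun ε hε R hR => ⟨-R - 1, by linarith, ?_⟩
  have hzero : v (-R - 1) = fun _ => 0 :=
    FixedPoint.slice_eq_zero hX2 hv hsm hens hL6 (by linarith)
  have h6 : eLpNorm (v (-R - 1)) 6 volume = 0 := by
    rw [hzero]
    exact eLpNorm_zero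
  rw [h6, ENNReal.zero_rpow_of_pos (by norm_num), zero_mul]
  exact hε

/-- **FIXED POINT, reshaping 4: the registered open stub `stub_sharpTwoGate` is EQUIVALENT to the
crux.** -/
theorem parabolicGaldiLiouville_iff_sharpTwoGate :
    Theses.GaldiLiouvilleGate.ParabolicGaldiLiouville ↔
    ∀ v : ℝ → EuclideanSpace ℝ (Fin 3) → EuclideanSpace ℝ (Fin 3),
      Literature.Analysis.FluidPDE.IsBoundedAncientMildSolution 1 v →
      ContDiffOn ℝ (⊤ : ℕ∞) (Function.uncurry v) (Set.Iio 0 ×ˢ Set.univ) →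
      (∃ C : NNReal, ∀ s < 0, ∫⁻ y, ENNReal.ofReal
          (Literature.Analysis.FluidPDE.frobeniusNormSq (fderiv ℝ (v s) y)) ≤ C) →
      (∀ s < 0, MeasureTheory.MemLp (v s) 6 MeasureTheory.volume) →
      (∀ ε : ENNReal, 0 < ε → ∀ R : ℝ, 0 < R → ∃ σ : ℝ, σ < -R ∧
        MeasureTheory.eLpNorm (v σ) 6 MeasureTheory.volume ^ (4 : ℝ) * ENNReal.ofReal (-σ) < ε) ∨
      (∃ (τ : ℕ → ℝ) (M : ENNReal), M < ⊤ ∧ Filter.Tendsto τ Filter.atTop Filter.atBot ∧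
        (∀ k, τ k < 0) ∧ ∀ k, MeasureTheory.eLpNorm (v (τ k)) 3 MeasureTheory.volume ≤ M) :=
  ⟨sharpTwoGate_of_parabolicGaldiLiouville, parabolicGaldiLiouville_of_sharpTwoGate⟩

/-- **FIXED POINT, reshaping 3: the two-gate stub (`∫E² < ∞` ∨ backward `L³`) is EQUIVALENT to the
crux.** Forward: `v ≡ 0` has zero enstrophy history. Backward: gate 1 ⇒
`DecayRung.eq_zero_of_sqIntegrableEnstrophy` (Seregin Thm 4.12 at `(6,4)`, p153466), gate B ⇒
`parabolicGaldiLiouville_L3Corner`. -/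
theorem parabolicGaldiLiouville_iff_twoGate :
    Theses.GaldiLiouvilleGate.ParabolicGaldiLiouville ↔
    ∀ v : ℝ → EuclideanSpace ℝ (Fin 3) → EuclideanSpace ℝ (Fin 3),
      Literature.Analysis.FluidPDE.IsBoundedAncientMildSolution 1 v →
      ContDiffOn ℝ (⊤ : ℕ∞) (Function.uncurry v) (Set.Iio 0 ×ˢ Set.univ) →
      (∃ C : NNReal, ∀ s < 0, ∫⁻ y, ENNReal.ofReal
          (Literature.Analysis.FluidPDE.frobeniusNormSq (fderiv ℝ (v s) y)) ≤ C) →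
      (∀ s < 0, MeasureTheory.MemLp (v s) 6 MeasureTheory.volume) →
      (∫⁻ s in Set.Iio 0, (∫⁻ y, ENNReal.ofReal
          (Literature.Analysis.FluidPDE.frobeniusNormSq (fderiv ℝ (v s) y))) ^ 2) < ⊤ ∨
      (∃ (τ : ℕ → ℝ) (M : ENNReal), M < ⊤ ∧ Filter.Tendsto τ Filter.atTop Filter.atBot ∧
        (∀ k, τ k < 0) ∧ ∀ k, MeasureTheory.eLpNorm (v (τ k)) 3 MeasureTheory.volume ≤ M) := by
  refine ⟨fun hX2 v hv hsm hens hL6 => Or.inl ?_, fun hstub v hv hsm hens hL6 => ?_⟩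
  · rw [FixedPoint.lintegral_enstrophy_pow_eq_zero hX2 hv hsm hens hL6 two_ne_zero]
    exact ENNReal.zero_lt_top
  · rcases hstub v hv hsm hens hL6 with hsq | hB
    · exact DecayRung.eq_zero_of_sqIntegrableEnstrophy hv hsm hL6 hsq
    · exact parabolicGaldiLiouville_L3Corner v hv hsm hens hL6 hB

/-- **FIXED POINT, reshaping 2: the sharp-gate stub (square-integrable enstrophy history) is
EQUIVALENT to the crux.** -/
theorem parabolicGaldiLiouville_iff_sqIntegrableEnstrophy :
    Theses.GaldiLiouvilleGate.ParabolicGaldiLiouville ↔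
    ∀ v : ℝ → EuclideanSpace ℝ (Fin 3) → EuclideanSpace ℝ (Fin 3),
      Literature.Analysis.FluidPDE.IsBoundedAncientMildSolution 1 v →
      ContDiffOn ℝ (⊤ : ℕ∞) (Function.uncurry v) (Set.Iio 0 ×ˢ Set.univ) →
      (∃ C : NNReal, ∀ s < 0, ∫⁻ y, ENNReal.ofReal
          (Literature.Analysis.FluidPDE.frobeniusNormSq (fderiv ℝ (v s) y)) ≤ C) →
      (∀ s < 0, MeasureTheory.MemLp (v s) 6 MeasureTheory.volume) →
      (∫⁻ s in Set.Iio 0, (∫⁻ y, ENNReal.ofReal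
          (Literature.Analysis.FluidPDE.frobeniusNormSq (fderiv ℝ (v s) y))) ^ 2) < ⊤ := by
  refine ⟨fun hX2 v hv hsm hens hL6 => ?_, fun hstub v hv hsm hens hL6 => ?_⟩
  · rw [FixedPoint.lintegral_enstrophy_pow_eq_zero hX2 hv hsm hens hL6 two_ne_zero]
    exact ENNReal.zero_lt_top
  · exact DecayRung.eq_zero_of_sqIntegrableEnstrophy hv hsm hL6 (hstub v hv hsm hens hL6)

/-- **FIXED POINT, reshaping 1 (birth): the dissipation-gate stub (finite total dissipation
`∫_{s<0} ∫|∇v|² < ∞`) is EQUIVALENT to the crux.** Backward through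
`FixedPoint.sqIntegrableEnstrophy_of_finiteDissipation` (`E ≤ C`) and reshaping 2. -/
theorem parabolicGaldiLiouville_iff_finiteDissipation :
    Theses.GaldiLiouvilleGate.ParabolicGaldiLiouville ↔
    ∀ v : ℝ → EuclideanSpace ℝ (Fin 3) → EuclideanSpace ℝ (Fin 3),
      Literature.Analysis.FluidPDE.IsBoundedAncientMildSolution 1 v →
      ContDiffOn ℝ (⊤ : ℕ∞) (Function.uncurry v) (Set.Iio 0 ×ˢ Set.univ) →
      (∃ C : NNReal, ∀ s < 0, ∫⁻ y, ENNReal.ofReal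
          (Literature.Analysis.FluidPDE.frobeniusNormSq (fderiv ℝ (v s) y)) ≤ C) →
      (∀ s < 0, MeasureTheory.MemLp (v s) 6 MeasureTheory.volume) →
      (∫⁻ s in Set.Iio 0, ∫⁻ y, ENNReal.ofReal
          (Literature.Analysis.FluidPDE.frobeniusNormSq (fderiv ℝ (v s) y))) < ⊤ := by
  refine ⟨fun hX2 v hv hsm hens hL6 => ?_, fun hstub v hv hsm hens hL6 => ?_⟩
  · have h := FixedPoint.lintegral_enstrophy_pow_eq_zero hX2 hv hsm hens hL6 one_ne_zero
    simp only [pow_one] at h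
    rw [h]
    exact ENNReal.zero_lt_top
  · exact DecayRung.eq_zero_of_sqIntegrableEnstrophy hv hsm hL6
      (FixedPoint.sqIntegrableEnstrophy_of_finiteDissipation hens (hstub v hv hsm hens hL6))

end Summit.NavierStokesRegularity.NavierStokesRegularity.Theorems.ParabolicGaldiLiouville.Birth

end
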